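import Literature.AlgebraicGeometry.Motives.HodgeStructureExoticClassesPropagate
import HarnessLib

/-!
# The Lefschetz decomposition of divisor classes and of Hodge classes: `Λ(Dᵖ) ⊆ D^{p-1}` (Milne's Thm. 5.9: "`Λ` is Lefschetz"),
# `Dᵖ = E ∧ D^{p-1} ⊕ Dᵖ_prim`, `Bᵖ = E ∧ B^{p-1} ⊕ Bᵖ_prim`, `d_p = d_{p-1} + dim Dᵖ_prim`, `b_p = b_{p-1} + dim Bᵖ_prim` (`2p ≤ g`)

[topic AlgebraicGeometry/Motives]

Layer `Literature/AlgebraicGeometry/Motives`, lane `lit-hodgefound` (Track 2 foundations library; prover seat `lit-hodgefound-p34`,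
generation 28, row g28-#11). THEOREMS ONLY (no `def`, no named fact, no instance, no notation; net debt `0`). Sequel of the seat's
g28-#8 (`Polarization.lefschetzProj_apply_mem_divisorClasses`: the Lefschetz components of a divisor class are divisor classes) and
g28-#10 (`Polarization.lefschetzPow_mem_divisorClasses_iff` / `…_hodgeClasses_iff`: detection after wedging with `E`), on the
tree's `Λ = lefschetzDual` / `lefschetzDualDeg` (`Motives/HodgeStructureExteriorPowerLefschetzDual`: `IsSymplectic.lefschetzDual_pow_mul_of_mem_primitive`,
`…lefschetzDual_eq_zero_of_mem_primitive`) and the primitive parts `Q.primitivePart g k = P^k` (`Motives/HodgeStructureExteriorPowerHodgeRiemann`,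
`…LefschetzPolarization`: `Polarization.lefschetzPart_zero_toSubmodule`).

## The sources, verbatim

J. S. Milne, *Lefschetz classes on abelian varieties*, Duke Math. J. 96 (1999) [Milne1999LefschetzClasses], §5 (pp. 664–665): "Any
`x ∈ Hˢ(X)` can be written uniquely in the form `x = Σ_{i ≥ 0, s-d} Lⁱ xᵢ` with `xᵢ` a primitive element of `H^{s-2i}(X)`. For
`x = Σ Lⁱ xᵢ ∈ Hˢ(X)`, define `Λx = Σ_{i ≥ s-d, 1} L^{i-1} xᵢ`, `ᶜΛx = Σ_{i ≥ s-d, 1} i(d-s+i+1) L^{i-1} xᵢ`, `*x = Σ (-1)^{(s-2i)(s-2i+1)/2} L^{d-s+i} xᵢ`.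
**Theorem 5.9.** Let `A` be an abelian variety over `Ω`. The correspondences `Λ`, `ᶜΛ`, and `*` between `A` and itself are all Lefschetz.
*Proof.* It is known (e.g., Kleiman 1968, p367) that `Λ`, regarded as a map of cohomology groups, is inverse to `L`. Since the latter
is Lefschetz, it commutes with the action of `L(A)`, which implies that the same is true of `Λ`, which is therefore Lefschetz.
Consequently, all elements of the `ℚ`-algebra `ℚ[L, Λ]` are Lefschetz." C. Voisin, *Hodge Theory and Complex Algebraic Geometry I*
[Voisin2002], Prop. 6.22 (Lefschetz decomposition, existence and uniqueness), Lemma 6.24 and its proof (`Λ(ω^{r+1} ∧ p) = (r+1)(g-k-r) ωʳ ∧ p`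
for `p` primitive).

## Reading on the carrier, and what is PROVED

`H` a `ℚ`-Hodge structure of odd weight `n` on `V`, `dim V = 2g`, `Q` a polarization, `E = E_Q`, `L = E ∧ ·`, `Λ = lefschetzDualDeg E g`
(the tree's `sl₂`-partner of `L`, Milne's `ᶜΛ`), `π_r = Q.lefschetzProj … r`, `P^k = Q.primitivePart g k`; `Dᵖ ⊆ Bᵖ ⊆ ⋀^{2p} V`, `2p ≤ g`.
The operator shadow of Thm. 5.9 on the carrier (the correspondence statement itself — `Λ` as a Lefschetz class on `A × A` — is not
formalised here):

* `Polarization.mem_divisorClasses_iff_forall_lefschetzProj_mem` — **`x ∈ Dᵖ ⟺` every Lefschetz component `π_r x ∈ Dᵖ`**.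
* **`Polarization.lefschetzDualDeg_apply_mem_divisorClasses` — `Λ(Dᵖ) ⊆ D^{p-1}`** ("`Λ` […] is therefore Lefschetz": `Λ(Eʳ⁺¹ ∧ φ) = c Eʳ ∧ φ` on
  the components, and `Eʳ ∧ φ ∈ D^{p-1}` since `E ∧ (Eʳ ∧ φ) = π_{r+1} x ∈ Dᵖ`, g28-#10's detection).
* `Polarization.range_lefschetzPow_one_inf_primitivePart_eq_bot` (`E ∧ ⋀^{2p-2} V ∩ P^{2p} = 0`, uniqueness of the decomposition),
  **`Polarization.divisorClasses_eq_map_sup_inf_primitivePart`: `Dᵖ = E ∧ D^{p-1} + (Dᵖ ∩ P^{2p})`** (a direct sum), and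
  **`Polarization.finrank_divisorClasses_eq_add_finrank_inf_primitivePart`: `d_p = d_{p-1} + dim(Dᵖ ∩ P^{2p})`** — the NEW divisor classes in
  degree `2p` are the primitive ones; the same for Hodge classes: `Polarization.hodgeClasses_eq_map_sup_inf_primitivePart`,
  `Polarization.finrank_hodgeClasses_eq_add_finrank_inf_primitivePart` (`b_p = b_{p-1} + dim(Bᵖ ∩ P^{2p})`), hence
  `Polarization.finrank_inf_primitivePart_divisorClasses_le` (`dim(Dᵖ ∩ P^{2p}) ≤ dim(Bᵖ ∩ P^{2p})`, with `e_p - e_{p-1}` the difference).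

## References

* [Milne1999LefschetzClasses] J. S. Milne, *Lefschetz classes on abelian varieties*, Duke Math. J. 96 (1999), §5 Thm. 5.9 and the
  definitions preceding it (pp. 664–665); §4 Cor. 4.5.
* [Voisin2002] C. Voisin, *Hodge Theory and Complex Algebraic Geometry I* (2002), Prop. 6.22, Lemma 6.24.
* [Lange2023AbelianVarietiesComplex] H. Lange, *Abelian Varieties over the Complex Numbers* (2023), §7.3.2 (1)–(3) (p. 338), Thm. 5.4.2.
* [Kleiman1968AlgebraicCycles] S. Kleiman, *Algebraic cycles and the Weil conjectures* (1968), §1.4 (via Milne's proof of Thm. 5.9).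
-/

noncomputable section

namespace Literature.AlgebraicGeometry.Motives.HodgeStructure

open ExteriorLefschetz ExteriorAlgebra

universe u

variable {V : Type u} [AddCommGroup V] [Module ℚ V] [Module.Finite ℚ V] {n : ℤ} {H : HodgeStructure V n}
  (Q : Polarization H) (hn : Odd n) {g : ℕ} (hg : Module.finrank ℚ V = 2 * g)

/-! ## §1 Divisor classes and the Lefschetz projections; `Λ(Dᵖ) ⊆ D^{p-1}` -/

/-- **`x ∈ Dᵖ ⟺ π_r x ∈ Dᵖ` for every `r`** (`2p ≤ g`; `x = Σ_r π_r x` and g28-#8's stability of `Dᵖ` under the `π_r`).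
[cite: Milne1999LefschetzClasses, §5 Prop. 5.1 (proof) and Thm. 5.9] [cite: Lange2023AbelianVarietiesComplex, Thm. 5.4.2] -/
theorem Polarization.mem_divisorClasses_iff_forall_lefschetzProj_mem {p : ℕ} (hk : 2 * p ≤ g) {x : ⋀[ℚ]^(2 * p) V} :
    x ∈ H.divisorClasses p ↔ ∀ r, (Q.lefschetzProj hn hg hk r).toLinearMap x ∈ H.divisorClasses p := by
  refine ⟨fun hx r ↦ Q.lefschetzProj_apply_mem_divisorClasses hn hg hk hx r, fun h ↦ ?_⟩
  rw [← Q.sum_lefschetzProj_apply hn hg hk x]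
  exact Submodule.sum_mem _ fun r _ ↦ h r

include hn hg in
/-- **MILNE'S THM. 5.9 ON THE CARRIER: `Λ(Dᵖ) ⊆ D^{p-1}`** (`2p ≤ g`). Writing `x = Σ_r Eʳ ∧ φ_r` (`φ_r` primitive), `Λ φ₀ = 0` and
`Λ(E^{r+1} ∧ φ_{r+1}) = (r+1)(g-2p+r+1) Eʳ ∧ φ_{r+1}`, where `Eʳ ∧ φ_{r+1} ∈ D^{p-1}` because `E ∧ (Eʳ ∧ φ_{r+1}) = π_{r+1} x ∈ Dᵖ`
(divisor classes are detected after wedging with `E`, and the Lefschetz components of `x` are divisor classes).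
[cite: Milne1999LefschetzClasses, §5 Thm. 5.9 (pp. 664–665)] [cite: Voisin2002, Lemma 6.24 (proof)] -/
theorem Polarization.lefschetzDualDeg_apply_mem_divisorClasses {p q : ℕ} (hk : 2 * p ≤ g) (h : 2 * q + 2 = 2 * p)
    {x : ⋀[ℚ]^(2 * p) V} (hx : x ∈ H.divisorClasses p) :
    lefschetzDualDeg (Q.lefschetzClass : ExteriorAlgebra ℚ V) g h x ∈ H.divisorClasses q := by
  have hω := Q.isSymplectic_lefschetzClass hn hg
  have hpq : p = q + 1 := by omega
  have hk2 : 2 * p / 2 + 1 = p + 1 := by omega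
  obtain ⟨φ, hφ, hφ0, hxdec⟩ := hω.exists_sum_pow_mul_primitive hk x.2
  have hφ' : ∀ s ∈ Finset.range (2 * p / 2 + 1),
      φ s ∈ ExteriorLefschetz.primitive (Q.lefschetzClass : ExteriorAlgebra ℚ V) g (2 * p - 2 * s) := fun s _ ↦ hφ s
  -- the pieces `Eˢ ∧ φ_{s+1} ∈ ⋀^{2q}`
  have hzmem : ∀ s, (Q.lefschetzClass : ExteriorAlgebra ℚ V) ^ s * φ (s + 1) ∈ ⋀[ℚ]^(2 * q) V := by
    intro s
    by_cases hs : s < p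
    · refine pow_mul_mem_of_mem_primitive Q.lefschetzClass.2 (g := g) (by omega) ?_
      rw [show 2 * q - 2 * s = 2 * p - 2 * (s + 1) by omega]
      exact hφ (s + 1)
    · rw [hφ0 (s + 1) (by omega), mul_zero]
      exact Submodule.zero_mem _
  have h1 : 2 * 1 + 2 * q = 2 * p := by omega
  -- `E ∧ (Eˢ ∧ φ_{s+1}) = π_{s+1} x`, hence the pieces are divisor classes
  have hzD : ∀ s ∈ Finset.range p,
      (⟨_, hzmem s⟩ : ⋀[ℚ]^(2 * q) V) ∈ H.divisorClasses q := by
    intro s hs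
    refine (Q.lefschetzPow_mem_divisorClasses_iff hn hg (by omega) h1).1 ?_
    have heq : lefschetzPow (Q.lefschetzClass : ExteriorAlgebra ℚ V) Q.lefschetzClass.2 1 h1 ⟨_, hzmem s⟩ =
        (Q.lefschetzProj hn hg hk (s + 1)).toLinearMap x := Subtype.ext (by
      change (Q.lefschetzClass : ExteriorAlgebra ℚ V) ^ 1 * ((Q.lefschetzClass : ExteriorAlgebra ℚ V) ^ s * φ (s + 1)) = _
      rw [Q.coe_lefschetzProj_apply_of_lefschetzDecomposition hn hg hk hφ' hxdec
        (Finset.mem_range.2 (by rw [Finset.mem_range] at hs; omega)), pow_one, ← mul_assoc, ← pow_succ'])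
    rw [heq]
    exact Q.lefschetzProj_apply_mem_divisorClasses hn hg hk hx (s + 1)
  -- `Λ x = Σ_s c_s Eˢ ∧ φ_{s+1}`
  have hΛ : lefschetzDual (Q.lefschetzClass : ExteriorAlgebra ℚ V) g (x : ExteriorAlgebra ℚ V) =
      ∑ s ∈ Finset.range p, ((((s + 1 : ℕ) : ℚ) * ((g : ℚ) - ((2 * p - 2 * (s + 1) : ℕ) : ℚ) - s))) •
        ((Q.lefschetzClass : ExteriorAlgebra ℚ V) ^ s * φ (s + 1)) := by
    rw [hxdec, map_sum, hk2, Finset.sum_range_succ', pow_zero, one_mul,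
      hω.lefschetzDual_eq_zero_of_mem_primitive (k := 2 * p - 2 * 0) (by omega) (hφ 0), add_zero]
    refine Finset.sum_congr rfl fun s hs ↦ ?_
    exact hω.lefschetzDual_pow_mul_of_mem_primitive (k := 2 * p - 2 * (s + 1))
      (by omega) (hφ (s + 1)) s
  have hval : lefschetzDualDeg (Q.lefschetzClass : ExteriorAlgebra ℚ V) g h x =
      ∑ s ∈ Finset.range p, ((((s + 1 : ℕ) : ℚ) * ((g : ℚ) - ((2 * p - 2 * (s + 1) : ℕ) : ℚ) - s))) •
        (⟨_, hzmem s⟩ : ⋀[ℚ]^(2 * q) V) := by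
    apply Subtype.ext
    rw [lefschetzDualDeg_apply_coe, hΛ, Submodule.coe_sum]
    refine Finset.sum_congr rfl fun s _ ↦ ?_
    rw [Submodule.coe_smul]
  rw [hval]
  exact Submodule.sum_mem _ fun s hs ↦ Submodule.smul_mem _ _ (hzD s hs)

/-! ## §2 The primitive decomposition of divisor classes and of Hodge classes -/

include hn hg in
/-- **`E ∧ ⋀^{2p-2} V ∩ P^{2p} = 0`** (`2p ≤ g`): an element in the image of `L` has no primitive component (uniqueness of the Lefschetz
decomposition). [cite: Voisin2002, Prop. 6.22] [cite: Lange2023AbelianVarietiesComplex, §7.3.2 (3) (p. 338)] -/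
theorem Polarization.range_lefschetzPow_one_inf_primitivePart_eq_bot {p q : ℕ} (hk : 2 * p ≤ g) (h : 2 * 1 + 2 * q = 2 * p) :
    LinearMap.range (lefschetzPow (Q.lefschetzClass : ExteriorAlgebra ℚ V) Q.lefschetzClass.2 1 h) ⊓
      (Q.primitivePart g (2 * p)).toSubmodule = ⊥ := by
  have hω := Q.isSymplectic_lefschetzClass hn hg
  rw [eq_bot_iff]
  intro y hy'
  obtain ⟨hy₁, hy⟩ := Submodule.mem_inf.1 hy'
  obtain ⟨w, rfl⟩ := LinearMap.mem_range.1 hy₁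
  rw [Polarization.primitivePart, primitiveSub_toSubmodule, Submodule.mem_comap, Submodule.subtype_apply,
    lefschetzPow_apply_coe, pow_one] at hy
  obtain ⟨ψ, hψ, -, hwdec⟩ := hω.exists_sum_pow_mul_primitive (k := 2 * q) (by omega) w.2
  -- `0 = -E w + Σ_s E^{s+1} ψ_s` is a Lefschetz decomposition of `0` in degree `2p`
  set χ : ℕ → ExteriorAlgebra ℚ V := fun r ↦ if r = 0 then -((Q.lefschetzClass : ExteriorAlgebra ℚ V) * w) else ψ (r - 1) with hχ
  have hχprim : ∀ r ∈ Finset.range (2 * p / 2 + 1),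
      χ r ∈ ExteriorLefschetz.primitive (Q.lefschetzClass : ExteriorAlgebra ℚ V) g (2 * p - 2 * r) := by
    intro r _
    by_cases hr : r = 0
    · subst hr
      simpa [hχ] using Submodule.neg_mem _ hy
    · simp only [hχ, hr, if_false]
      have := hψ (r - 1)
      rwa [show 2 * q - 2 * (r - 1) = 2 * p - 2 * r by omega] at this
  have hsum : ∑ r ∈ Finset.range (2 * p / 2 + 1), (Q.lefschetzClass : ExteriorAlgebra ℚ V) ^ r * χ r = 0 := by
    have hq2 : 2 * q / 2 + 1 = q + 1 := by omega
    rw [hq2] at hwdec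
    have hχ0 : χ 0 = -((Q.lefschetzClass : ExteriorAlgebra ℚ V) * w) := by simp [hχ]
    have hχs : ∀ r, χ (r + 1) = ψ r := fun r ↦ by simp [hχ]
    rw [show 2 * p / 2 + 1 = (q + 1) + 1 by omega, Finset.sum_range_succ', hχ0, pow_zero, one_mul, hwdec, Finset.mul_sum,
      ← Finset.sum_neg_distrib, ← Finset.sum_add_distrib]
    refine Finset.sum_eq_zero fun r _ ↦ ?_
    rw [hχs, pow_succ', mul_assoc, add_neg_cancel]
  have h0 := hω.eq_zero_of_sum_pow_mul_primitive_eq_zero hk hχprim hsum 0 (Finset.mem_range.2 (by omega))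
  simp only [hχ, if_true, neg_eq_zero] at h0
  rw [Submodule.mem_bot]
  exact Subtype.ext (by rw [lefschetzPow_apply_coe, pow_one, h0, ZeroMemClass.coe_zero])


include hn hg in
/-- Structural lemma: for `x ∈ ⋀^{2p} V` (`2p ≤ g`, `p = q + 1`) with Lefschetz decomposition `x = Σ_r Eʳ ∧ φ_r`, the pieces
`z_s = Eˢ ∧ φ_{s+1} ∈ ⋀^{2q} V` satisfy `E ∧ z_s = π_{s+1} x` and `x = π₀ x + E ∧ Σ_s z_s` (bookkeeping for the Lefschetz
decomposition). [folklore] [cite: Voisin2002, Prop. 6.22] -/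
private theorem Polarization.exists_lefschetz_pieces {p q : ℕ} (hk : 2 * p ≤ g) (h : 2 * 1 + 2 * q = 2 * p) (x : ⋀[ℚ]^(2 * p) V) :
    ∃ z : ℕ → ⋀[ℚ]^(2 * q) V,
      (∀ s ∈ Finset.range p, lefschetzPow (Q.lefschetzClass : ExteriorAlgebra ℚ V) Q.lefschetzClass.2 1 h (z s) =
        (Q.lefschetzProj hn hg hk (s + 1)).toLinearMap x) ∧
      x = (Q.lefschetzProj hn hg hk 0).toLinearMap x +
        lefschetzPow (Q.lefschetzClass : ExteriorAlgebra ℚ V) Q.lefschetzClass.2 1 h (∑ s ∈ Finset.range p, z s) := by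
  have hω := Q.isSymplectic_lefschetzClass hn hg
  have hk2 : 2 * p / 2 + 1 = p + 1 := by omega
  obtain ⟨φ, hφ, hφ0, hxdec⟩ := hω.exists_sum_pow_mul_primitive hk x.2
  have hφ' : ∀ s ∈ Finset.range (2 * p / 2 + 1),
      φ s ∈ ExteriorLefschetz.primitive (Q.lefschetzClass : ExteriorAlgebra ℚ V) g (2 * p - 2 * s) := fun s _ ↦ hφ s
  have hzmem : ∀ s, (Q.lefschetzClass : ExteriorAlgebra ℚ V) ^ s * φ (s + 1) ∈ ⋀[ℚ]^(2 * q) V := by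
    intro s
    by_cases hs : s < p
    · refine pow_mul_mem_of_mem_primitive Q.lefschetzClass.2 (g := g) (by omega) ?_
      rw [show 2 * q - 2 * s = 2 * p - 2 * (s + 1) by omega]
      exact hφ (s + 1)
    · rw [hφ0 (s + 1) (by omega), mul_zero]
      exact Submodule.zero_mem _
  have heq : ∀ s ∈ Finset.range p, lefschetzPow (Q.lefschetzClass : ExteriorAlgebra ℚ V) Q.lefschetzClass.2 1 h ⟨_, hzmem s⟩ =
      (Q.lefschetzProj hn hg hk (s + 1)).toLinearMap x := fun s hs ↦ Subtype.ext (by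
    change (Q.lefschetzClass : ExteriorAlgebra ℚ V) ^ 1 * ((Q.lefschetzClass : ExteriorAlgebra ℚ V) ^ s * φ (s + 1)) = _
    rw [Q.coe_lefschetzProj_apply_of_lefschetzDecomposition hn hg hk hφ' hxdec
      (Finset.mem_range.2 (by rw [Finset.mem_range] at hs; omega)), pow_one, ← mul_assoc, ← pow_succ'])
  refine ⟨fun s ↦ ⟨_, hzmem s⟩, heq, ?_⟩
  rw [map_sum, Finset.sum_congr rfl heq]
  conv_lhs => rw [← Q.sum_lefschetzProj_apply hn hg hk x, hk2, Finset.sum_range_succ']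
  rw [add_comm]

include hn hg in
/-- **THE PRIMITIVE DECOMPOSITION OF DIVISOR CLASSES: `Dᵖ = E ∧ D^{p-1} + (Dᵖ ∩ P^{2p})`** (`2p ≤ g`, `p = q + 1`; the sum is direct by
`range_lefschetzPow_one_inf_primitivePart_eq_bot`): `x = π₀ x + E ∧ Σ_s z_s` with `π₀ x ∈ Dᵖ ∩ P^{2p}` and `z_s ∈ D^{p-1}`
(`E ∧ z_s = π_{s+1} x ∈ Dᵖ`). [cite: Milne1999LefschetzClasses, §5 Thm. 5.9 and Prop. 5.1 (proof)] [cite: Voisin2002, Prop. 6.22] -/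
theorem Polarization.divisorClasses_eq_map_sup_inf_primitivePart {p q : ℕ} (hk : 2 * p ≤ g) (h : 2 * 1 + 2 * q = 2 * p) :
    H.divisorClasses p =
      (H.divisorClasses q).map (lefschetzPow (Q.lefschetzClass : ExteriorAlgebra ℚ V) Q.lefschetzClass.2 1 h) ⊔
        (H.divisorClasses p ⊓ (Q.primitivePart g (2 * p)).toSubmodule) := by
  refine le_antisymm (fun x hx ↦ ?_)
    (sup_le (map_lefschetzPow_divisorClasses_le H Q.lefschetzClass_mem_hodgeClasses 1 h) inf_le_left)
  obtain ⟨z, hzL, hxz⟩ := Q.exists_lefschetz_pieces hn hg hk h x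
  have hzD : ∀ s ∈ Finset.range p, z s ∈ H.divisorClasses q := fun s hs ↦ by
    refine (Q.lefschetzPow_mem_divisorClasses_iff hn hg (by omega) h).1 ?_
    rw [hzL s hs]
    exact Q.lefschetzProj_apply_mem_divisorClasses hn hg hk hx (s + 1)
  have hπ0 : (Q.lefschetzProj hn hg hk 0).toLinearMap x ∈ (Q.primitivePart g (2 * p)).toSubmodule := by
    have := Q.lefschetzProj_apply_mem hn hg hk 0 x
    rwa [Q.lefschetzPart_zero_toSubmodule] at this
  rw [hxz]
  exact Submodule.add_mem _
    (Submodule.mem_sup_right (Submodule.mem_inf.2 ⟨Q.lefschetzProj_apply_mem_divisorClasses hn hg hk hx 0, hπ0⟩))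
    (Submodule.mem_sup_left ⟨_, Submodule.sum_mem _ hzD, rfl⟩)

include Q hn hg in
/-- **`d_p = d_{p-1} + dim(Dᵖ ∩ P^{2p})` for `1 ≤ p`, `2p ≤ g`**: the new divisor classes in degree `2p` are exactly the primitive ones
(`E ∧ · : D^{p-1} ↪ Dᵖ` is injective and misses `P^{2p}`). [cite: Milne1999LefschetzClasses, §5 Thm. 5.9] [cite: Voisin2002, Prop. 6.22] -/
theorem Polarization.finrank_divisorClasses_eq_add_finrank_inf_primitivePart {p : ℕ} (hp : 1 ≤ p) (hk : 2 * p ≤ g) :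
    Module.finrank ℚ ↥(H.divisorClasses p) =
      Module.finrank ℚ ↥(H.divisorClasses (p - 1)) +
        Module.finrank ℚ ↥(H.divisorClasses p ⊓ (Q.primitivePart g (2 * p)).toSubmodule) := by
  have h : 2 * 1 + 2 * (p - 1) = 2 * p := by omega
  have hinj := (Q.isSymplectic_lefschetzClass hn hg).lefschetzPow_injective (k := 2 * (p - 1)) (j := 1) (by omega) h
  have key := Submodule.finrank_sup_add_finrank_inf_eq
    ((H.divisorClasses (p - 1)).map (lefschetzPow (Q.lefschetzClass : ExteriorAlgebra ℚ V) Q.lefschetzClass.2 1 h))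
    (H.divisorClasses p ⊓ (Q.primitivePart g (2 * p)).toSubmodule)
  have hbot : (H.divisorClasses (p - 1)).map (lefschetzPow (Q.lefschetzClass : ExteriorAlgebra ℚ V) Q.lefschetzClass.2 1 h) ⊓
      (H.divisorClasses p ⊓ (Q.primitivePart g (2 * p)).toSubmodule) = ⊥ :=
    eq_bot_iff.2 ((inf_le_inf LinearMap.map_le_range inf_le_right).trans
      (Q.range_lefschetzPow_one_inf_primitivePart_eq_bot hn hg hk h).le)
  rw [← Q.divisorClasses_eq_map_sup_inf_primitivePart hn hg hk h, hbot, finrank_bot, add_zero,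
    ← LinearEquiv.finrank_eq (Submodule.equivMapOfInjective _ hinj (H.divisorClasses (p - 1)))] at key
  exact key

include hn hg in
/-- **THE PRIMITIVE DECOMPOSITION OF HODGE CLASSES: `Bᵖ = E ∧ B^{p-1} + (Bᵖ ∩ P^{2p})`** (`2p ≤ g`, `p = q + 1`): the same with "Hodge
class" for "divisor class" (`π_r` and `E ∧ ·` are morphisms of Hodge structures; detection after wedging with `E`, g28-#10).
[cite: Deligne1982HodgeCycles, I §2, 2.1 (c)] [cite: Voisin2002, Prop. 6.22 and Lemma 6.24] -/
theorem Polarization.hodgeClasses_eq_map_sup_inf_primitivePart {p q : ℕ} (hk : 2 * p ≤ g) (h : 2 * 1 + 2 * q = 2 * p) :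
    (H.exteriorPower (2 * p)).hodgeClasses (p * n) =
      ((H.exteriorPower (2 * q)).hodgeClasses (q * n)).map
          (lefschetzPow (Q.lefschetzClass : ExteriorAlgebra ℚ V) Q.lefschetzClass.2 1 h) ⊔
        ((H.exteriorPower (2 * p)).hodgeClasses (p * n) ⊓ (Q.primitivePart g (2 * p)).toSubmodule) := by
  have hidx : (q : ℤ) * n + ((1 : ℕ) : ℤ) * n = (p : ℤ) * n := by
    rw [show p = q + 1 by omega]; push_cast; ring
  refine le_antisymm (fun x hx ↦ ?_) (sup_le ?_ inf_le_left)
  swap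
  · have hle := map_lefschetzPow_hodgeClasses_le H Q.lefschetzClass_mem_hodgeClasses 1 h ((q : ℤ) * n)
    rwa [hidx] at hle
  obtain ⟨z, hzL, hxz⟩ := Q.exists_lefschetz_pieces hn hg hk h x
  have hzB : ∀ s ∈ Finset.range p, z s ∈ (H.exteriorPower (2 * q)).hodgeClasses (q * n) := fun s hs ↦ by
    refine (Q.lefschetzPow_mem_hodgeClasses_iff hn hg (by omega) h).1 ?_
    rw [hzL s hs, hidx]
    exact (Q.lefschetzProj hn hg hk (s + 1)).map_hodgeClasses_le _ ⟨x, hx, rfl⟩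
  have hπ0 : (Q.lefschetzProj hn hg hk 0).toLinearMap x ∈ (Q.primitivePart g (2 * p)).toSubmodule := by
    have := Q.lefschetzProj_apply_mem hn hg hk 0 x
    rwa [Q.lefschetzPart_zero_toSubmodule] at this
  rw [hxz]
  exact Submodule.add_mem _
    (Submodule.mem_sup_right (Submodule.mem_inf.2 ⟨(Q.lefschetzProj hn hg hk 0).map_hodgeClasses_le _ ⟨x, hx, rfl⟩, hπ0⟩))
    (Submodule.mem_sup_left ⟨_, Submodule.sum_mem _ hzB, rfl⟩)

include Q hn hg in
/-- **`b_p = b_{p-1} + dim(Bᵖ ∩ P^{2p})` for `1 ≤ p`, `2p ≤ g`** (the new Hodge classes in degree `2p` are the primitive ones).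
[cite: Deligne1982HodgeCycles, I §2, 2.1 (c)] [cite: Voisin2002, Prop. 6.22 and Lemma 6.24] -/
theorem Polarization.finrank_hodgeClasses_eq_add_finrank_inf_primitivePart {p : ℕ} (hp : 1 ≤ p) (hk : 2 * p ≤ g) :
    Module.finrank ℚ ↥((H.exteriorPower (2 * p)).hodgeClasses (p * n)) =
      Module.finrank ℚ ↥((H.exteriorPower (2 * (p - 1))).hodgeClasses ((p - 1 : ℕ) * n)) +
        Module.finrank ℚ ↥((H.exteriorPower (2 * p)).hodgeClasses (p * n) ⊓ (Q.primitivePart g (2 * p)).toSubmodule) := by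
  have h : 2 * 1 + 2 * (p - 1) = 2 * p := by omega
  have hinj := (Q.isSymplectic_lefschetzClass hn hg).lefschetzPow_injective (k := 2 * (p - 1)) (j := 1) (by omega) h
  have key := Submodule.finrank_sup_add_finrank_inf_eq
    (((H.exteriorPower (2 * (p - 1))).hodgeClasses ((p - 1 : ℕ) * n)).map
      (lefschetzPow (Q.lefschetzClass : ExteriorAlgebra ℚ V) Q.lefschetzClass.2 1 h))
    ((H.exteriorPower (2 * p)).hodgeClasses (p * n) ⊓ (Q.primitivePart g (2 * p)).toSubmodule)
  have hbot : ((H.exteriorPower (2 * (p - 1))).hodgeClasses ((p - 1 : ℕ) * n)).map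
        (lefschetzPow (Q.lefschetzClass : ExteriorAlgebra ℚ V) Q.lefschetzClass.2 1 h) ⊓
      ((H.exteriorPower (2 * p)).hodgeClasses (p * n) ⊓ (Q.primitivePart g (2 * p)).toSubmodule) = ⊥ :=
    eq_bot_iff.2 ((inf_le_inf LinearMap.map_le_range inf_le_right).trans
      (Q.range_lefschetzPow_one_inf_primitivePart_eq_bot hn hg hk h).le)
  rw [← Q.hodgeClasses_eq_map_sup_inf_primitivePart hn hg hk h, hbot, finrank_bot, add_zero,
    ← LinearEquiv.finrank_eq (Submodule.equivMapOfInjective _ hinj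
      ((H.exteriorPower (2 * (p - 1))).hodgeClasses ((p - 1 : ℕ) * n)))] at key
  exact key

/-- **`dim(Dᵖ ∩ P^{2p}) ≤ dim(Bᵖ ∩ P^{2p})`**: primitive divisor classes are primitive Hodge classes (the difference counts the
primitive exotic classes, `e_p - e_{p-1}`). [cite: Milne1999LefschetzClasses, p. 660 and §5 Thm. 5.9] -/
theorem Polarization.finrank_inf_primitivePart_divisorClasses_le (p : ℕ) :
    Module.finrank ℚ ↥(H.divisorClasses p ⊓ (Q.primitivePart g (2 * p)).toSubmodule) ≤
      Module.finrank ℚ ↥((H.exteriorPower (2 * p)).hodgeClasses (p * n) ⊓ (Q.primitivePart g (2 * p)).toSubmodule) :=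
  Submodule.finrank_mono (inf_le_inf_right _ (divisorClasses_le_hodgeClasses H p))

end Literature.AlgebraicGeometry.Motives.HodgeStructure

end
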